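import Summits.AtomisticToContinuum.Crystallization.Theorems.FrustratedLawDichotomyStrainedPatchHomExteriorPSD
import Summits.AtomisticToContinuum.Crystallization.Theorems.FrustratedLawDichotomyStrainedPatchHomExteriorAnnulus

/-!
# Strained patch, `(H)` hcp exterior certificate (architecture R3) — E3: THE EXTERIOR SLAB LEAF v2 `exteriorOK2` (hand-1 g40 NOTE l.7506 (B1)/(B3)(i)/(C)): EXACT PSD
# direction floor (`psd3`, hand-1 p854132) OR Gershgorin, the GAP MEASURED FROM THE REFERENCE RANGE `[cC ± jw J wC]` (no moat beyond the sheet's own excursion), and the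
# PARTS form (per-box `curvCheckLJM` facts decided separately, each ≤ 100 s)  (decomp-a2c hand 2, generation 39; structural #17)

v1 (`…HomExteriorLeaf.exteriorOK`, p854110) measured the cell/slab gap from the CELL BOX and used the Gershgorin floor only; hand-1 g40's reach analysis (B1–B3): the exact
floor gains ×2.7 on λ, and measuring the gap from the REFERENCE RANGE `|ξ₀ m − cC_m/SC| ≤ jw J wC m / SC` (`abs_affShuf_sub_le`, no `jacOK` needed) removes the moat
between the natural cell box and the first slab.  This module: `jwBox`, `floorOK := gersh3 || psd3` (+ `floorOK_sound`), `extCurvAll` (the expensive per-box curvature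
facts, separable), `extRest2` (everything else, cheap), ★ `exteriorOK2 := extRest2 && extCurvAll`, ★ `exteriorOK2_of_parts`, ★★★ `exteriorOK2_sound` (full `hver` shape,
every `μ`; proof = v1's with the two substitutions); the semantic packaging / menu rides a follow-up.  0 sorry; standard axioms; computable defs.  `--supports stmt-AtomisticToContinuum-27623`.
-/

noncomputable section

open Set

namespace Summit.AtomisticToContinuum.Crystallization.Theorems.FrustratedLawDichotomyStrainedPatchHomExteriorRay

open scoped BigOperators RealInnerProductSpace
open Literature.Analysis.ValidatedNumerics.Numerics
open Summit.AtomisticToContinuum.Crystallization.Theorems.ChargedEnergyGapNegative (E3)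
open Summit.AtomisticToContinuum.Crystallization.Theorems.FrustratedLawDichotomySchurCut (effPot w₄₅ ω₄)
open Summit.AtomisticToContinuum.Crystallization.Theorems.FrustratedLawDichotomyAveragingRuleTightFree (TightNearCap BadNearCap)
open Summit.AtomisticToContinuum.Crystallization.Theorems.FrustratedLawDichotomyExemptAbsorption (ExemptNear)
open Summit.AtomisticToContinuum.Crystallization.Theorems.FrustratedLawDichotomyStrainedPatchHomSplit (ExRec latPt hexFrame hcpShift)
open Summit.AtomisticToContinuum.Crystallization.Theorems.FrustratedLawDichotomyStrainedPatchTaylorChord (segGd)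
open Summit.AtomisticToContinuum.Crystallization.Theorems.FrustratedLawDichotomyStrainedPatchHomCurvLeaf (nodup_filter_append toFinset_filter_append)
open Summit.AtomisticToContinuum.Crystallization.Theorems.FrustratedLawDichotomyStrainedPatchHomCurvLJ (curvCheckLJM ljLabelOK)
open Summit.AtomisticToContinuum.Crystallization.Theorems.FrustratedLawDichotomyStrainedPatchHomForceJacN (fjQ boxLabels11 boxLabels11_toFinset)
open Summit.AtomisticToContinuum.Crystallization.Theorems.FrustratedLawDichotomyStrainedPatchHomForceHcp (xiBallOK norm_le_quarter_of_xiBallOK)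
open Summit.AtomisticToContinuum.Crystallization.Theorems.FrustratedLawDichotomyStrainedPatchHomSlopeLJAffine (affShuf abs_affShuf_sub_le jw)
open Summit.AtomisticToContinuum.Crystallization.Theorems.FrustratedLawDichotomyStrainedPatchHomEntryLeafHT (htBU htRU htUniv htIn htK htROKU htBU_nodup
  htNaiOKA2 htGsA2 refForce_chunkA2_le jacOK jacOK_spec norm_le_seven_of_htIn lo_le_of_norm_le_seven six_le_norm_of_lo seven_lt_norm_of_not_mem_htUniv
  mem_boxLabels11_of_mem_htUniv mem_htUniv_of_mem_htBU htIn_of_mem_htBU mem_htBU_of_htIn)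

/-! ## §1 The reference-range box, the combined floor, the separable curvature facts -/

/-- The box whose ξ-half-widths are the affine reference's excursion `jw J wC` (entry part = the cell's). -/
def jwBox (J : Fin 3 → Fin 3 × Fin 3 → ℤ) (wC : Bx) : Bx := fun k => match k with
  | Sum.inl ab => wC (Sum.inl ab)
  | Sum.inr m => jw J wC m

/-- The direction floor: Gershgorin OR the exact PSD test (hand-1 g40 `psd3`, p854132). -/
def floorOK (D : Fin 3 → Fin 3 → ℤ) (lam lmin : ℤ) : Bool := gersh3 D lam lmin || psd3 D lam lmin

/-- ★ Soundness of the combined floor. [formal bookkeeping] -/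
theorem floorOK_sound {D : Fin 3 → Fin 3 → ℤ} {lam lmin : ℤ} (h : floorOK D lam lmin = true) (v : E3) :
    (lmin : ℝ) / SC * ‖v‖ ^ 2 ≤ (lam : ℝ) / SC * ‖v‖ ^ 2 + ∑ i : Fin 3, ∑ j : Fin 3, (D i j : ℝ) / SC * (v i * v j) := by
  simp only [floorOK, Bool.or_eq_true] at h
  rcases h with h | h
  · exact gersh3_sound h v
  · exact psd3_sound h v

/-- THE EXPENSIVE PART, separable: the per-box curvature certificates over the hull label list. -/
def extCurvAll (B : List (Fin 3 → ℤ)) (ch : List (Bx × Bx × (Fin 3 → Fin 3 → ℤ) × ℤ)) : Bool :=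
  (List.range ch.length).all fun k =>
    curvCheckLJM (chC ch k) (chW ch k) (B.filter fun b => ljLabelOK (chC ch k) (chW ch k) b) (B.filter fun b => !ljLabelOK (chC ch k) (chW ch k) b)
      (chD ch k) (chL ch k)

/-- The cheap per-box part: the direction floors. -/
def extFloorAll (ch : List (Bx × Bx × (Fin 3 → Fin 3 → ℤ) × ℤ)) (lmin : ℤ) : Bool :=
  (List.range ch.length).all fun k => floorOK (chD ch k) (chL ch k) lmin

/-! ## §3 ★★★ The exterior slab leaf and its soundness -/

/-- Everything of the v2 exterior leaf EXCEPT the per-box curvature certificates (cheap; one `decide`). -/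
def extRest2 (J : Fin 3 → Fin 3 × Fin 3 → ℤ) (cC wC cH wH : Bx) (ch : List (Bx × Bx × (Fin 3 → Fin 3 → ℤ) × ℤ)) (lmin g : ℤ) (i : Fin 3)
    (c w : Bx) : Bool :=
  sameU c w cC wC && sameU c w cH wH && xiBallOK cH wH && jacOK J wC && decide (htK cH wH < (SC : ℤ)) && htROKU cH wH &&
  htNaiOKA2 cC wC J (htBU cH wH) && decide (0 < ch.length) && extFloorAll ch lmin && extGeomOK cC wC ch c w &&
  xiSub cC wC cH wH && xiSub c w cH wH && decide (0 < g) && decide (0 ≤ lmin) &&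
  decide (cC (Sum.inr i) + jw J wC i + g ≤ c (Sum.inr i) - w (Sum.inr i) ∨ c (Sum.inr i) + w (Sum.inr i) + g ≤ cC (Sum.inr i) - jw J wC i) &&
  decide (4 * (SC : ℤ) ^ 2 * 8892 * 279936 + 4 * (SC : ℤ) * htGsA2 cC wC J (htBU cH wH) * 230539333248 +
      4 * (SC : ℤ) ^ 2 * ((htRU cH wH).length : ℤ) * 823543 < 3 * lmin * g * 230539333248)

/-- ★★★ **THE EXTERIOR SLAB LEAF v2**: `extRest2 && extCurvAll` — PSD-or-Gershgorin floors, gap from the reference range `[cC ± jw]`, separable curvature facts. -/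
def exteriorOK2 (J : Fin 3 → Fin 3 × Fin 3 → ℤ) (cC wC cH wH : Bx) (ch : List (Bx × Bx × (Fin 3 → Fin 3 → ℤ) × ℤ)) (lmin g : ℤ) (i : Fin 3)
    (c w : Bx) : Bool :=
  extRest2 J cC wC cH wH ch lmin g i c w && extCurvAll (htBU cH wH) ch

/-- ★ **PARTS**: the cheap rest (one `decide`) + the per-box curvature facts (one `decide` each, ≈ 77 s) ⟹ the leaf. [formal bookkeeping] -/
theorem exteriorOK2_of_parts {J : Fin 3 → Fin 3 × Fin 3 → ℤ} {cC wC cH wH : Bx} {ch : List (Bx × Bx × (Fin 3 → Fin 3 → ℤ) × ℤ)} {lmin g : ℤ} {i : Fin 3}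
    {c w : Bx} (hrest : extRest2 J cC wC cH wH ch lmin g i c w = true)
    (hcurv : ∀ k, k < ch.length → curvCheckLJM (chC ch k) (chW ch k) ((htBU cH wH).filter fun b => ljLabelOK (chC ch k) (chW ch k) b)
      ((htBU cH wH).filter fun b => !ljLabelOK (chC ch k) (chW ch k) b) (chD ch k) (chL ch k) = true) :
    exteriorOK2 J cC wC cH wH ch lmin g i c w = true := by
  unfold exteriorOK2 extCurvAll
  simp only [Bool.and_eq_true, List.all_eq_true, List.mem_range]
  exact ⟨hrest, hcurv⟩

/-- ★★★ **SOUNDNESS OF THE EXTERIOR SLAB LEAF v2 in the full `hver` shape, at EVERY level `μ`.** [folklore chaining: v1's proof with `floorOK_sound` and the gap measured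
from the reference range `jwBox J wC`] -/
theorem exteriorOK2_sound {μ : ℤ} {J : Fin 3 → Fin 3 × Fin 3 → ℤ} {cC wC cH wH : Bx} {ch : List (Bx × Bx × (Fin 3 → Fin 3 → ℤ) × ℤ)} {lmin g : ℤ} {i : Fin 3}
    {c w : Bx} (h : exteriorOK2 J cC wC cH wH ch lmin g i c w = true) (U : E3 →L[ℝ] E3) (ξ : E3)
    (_hsa : ∀ v v' : E3, ⟪U v, v'⟫ = ⟪v, U v'⟫) (hU : ‖U - 1‖ ≤ 1 / 4)
    (hbox : ∀ ab : Fin 3 × Fin 3, |(U (EuclideanSpace.single ab.2 (1 : ℝ))) ab.1 - (c (Sum.inl ab) : ℝ) / SC| ≤ (w (Sum.inl ab) : ℝ) / SC)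
    (hξ : ∀ i : Fin 3, |ξ i - (c (Sum.inr i) : ℝ) / SC| ≤ (w (Sum.inr i) : ℝ) / SC) (_h0 : 0 ≤ ξ 0) (_h2 : 0 ≤ ξ 2) :
    (∀ (M : ℕ) (z : Fin M → E3) (cc : Fin M), Function.Injective z →
        Set.range z = {x : E3 | dist x (z cc) ≤ 133 / 10 ∧ ∃ a : Fin 3 → ℤ,
          x = z cc + latPt U hexFrame a ∨ x = z cc + latPt U hexFrame a + U (hcpShift + ξ)} →
        TightNearCap (9 / 5) (3 / 2) z cc ∨ ExemptNear (9 / 5) ExRec z cc ∨ BadNearCap (9 / 5) (3 / 2) z cc) ∨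
      (μ : ℝ) / SC ≤ ∑ b ∈ (Fintype.piFinset fun _ : Fin 3 => Finset.Icc (-7 : ℤ) 7).filter (fun b => b ≠ 0), effPot w₄₅ ω₄ (3 / 400) ‖latPt U hexFrame b‖ +
        ∑ b ∈ (Fintype.piFinset fun _ : Fin 3 => Finset.Icc (-7 : ℤ) 7), effPot w₄₅ ω₄ (3 / 400) ‖latPt U hexFrame b + U (hcpShift + ξ)‖ := by
  classical
  have hS : (0 : ℝ) < SC := SC_pos
  unfold exteriorOK2 extRest2 at h
  simp only [Bool.and_eq_true, decide_eq_true_eq] at h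
  obtain ⟨⟨⟨⟨⟨⟨⟨⟨⟨⟨⟨⟨⟨⟨⟨⟨hUC, hUH⟩, hball⟩, hjac⟩, hKlt⟩, hROK⟩, hNai⟩, hlen⟩, hfloors⟩, hgeom⟩, hCH⟩, hSH⟩, hg⟩, hlmin⟩, hgap⟩, hdomZ⟩, hcurvs⟩ := h
  -- entry boxes
  have hboxC := hbox_of_sameU hUC hbox
  have hboxH := hbox_of_sameU hUH hbox
  -- the reference: the cell's affine sheet point
  set ξ₀ : E3 := affShuf J cC U with hξ₀def
  have hξ₀C : ∀ m : Fin 3, |ξ₀ m - (cC (Sum.inr m) : ℝ) / SC| ≤ (wC (Sum.inr m) : ℝ) / SC := by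
    intro m
    refine (abs_affShuf_sub_le (J := J) (w := wC) U hboxC m).trans ?_
    rw [div_le_div_iff_of_pos_right hS]
    exact_mod_cast jacOK_spec hjac m
  have hξ₀J : ∀ m : Fin 3, |ξ₀ m - (cC (Sum.inr m) : ℝ) / SC| ≤ (jwBox J wC (Sum.inr m) : ℝ) / SC :=
    fun m => abs_affShuf_sub_le (J := J) (w := wC) U hboxC m
  have hξ₀H := hxi_of_xiSub hCH hξ₀C
  have hξH := hxi_of_xiSub hSH hξ
  have hn₀ : ‖ξ₀‖ ≤ 1 / 4 := norm_le_quarter_of_xiBallOK hball hξ₀H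
  have hn : ‖ξ‖ ≤ 1 / 4 := norm_le_quarter_of_xiBallOK hball hξH
  -- label finsets from the HULL box (verbatim the cell proof's block at (cH, wH))
  set B : Finset (Fin 3 → ℤ) := (htBU cH wH).toFinset with hBdef
  set R : Finset (Fin 3 → ℤ) := (htRU cH wH).toFinset with hRdef
  have hB : B ⊆ Fintype.piFinset fun _ : Fin 3 => Finset.Icc (-11 : ℤ) 11 := by
    intro b hb
    rw [← boxLabels11_toFinset]
    exact List.mem_toFinset.2 (mem_boxLabels11_of_mem_htUniv (mem_htUniv_of_mem_htBU (List.mem_toFinset.1 hb)))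
  have hBin : ∀ bb ∈ B, ‖latPt U hexFrame bb + U (hcpShift + ξ)‖ ≤ 7 :=
    fun bb hbb => norm_le_seven_of_htIn U hboxH ξ hξH (htIn_of_mem_htBU (List.mem_toFinset.1 hbb))
  have hROK' : ∀ b ∈ htRU cH wH, 36 * (SC : ℤ) ≤ (fjQ cH wH b).lo := by
    intro b hb
    have := List.all_eq_true.1 hROK b hb
    simpa using this
  have hR : ∀ bb ∈ (Fintype.piFinset fun _ : Fin 3 => Finset.Icc (-11 : ℤ) 11) \ B, ‖latPt U hexFrame bb + U (hcpShift + ξ)‖ ≤ 7 →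
      bb ∈ R ∧ 6 ≤ ‖latPt U hexFrame bb + U (hcpShift + ξ)‖ := by
    intro bb hbb h7
    obtain ⟨hbox11, hnotB⟩ := Finset.mem_sdiff.1 hbb
    rw [← boxLabels11_toFinset] at hbox11
    have hbL : bb ∈ boxLabels11 := List.mem_toFinset.1 hbox11
    have hlo := lo_le_of_norm_le_seven U hboxH ξ hξH h7
    by_cases huniv : bb ∈ htUniv cH wH
    swap
    · exact absurd h7 (not_le.2 (seven_lt_norm_of_not_mem_htUniv U hboxH hξH hKlt hbL huniv))
    by_cases hin : htIn cH wH bb = true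
    · exact absurd (List.mem_toFinset.2 (mem_htBU_of_htIn huniv hin)) hnotB
    · have hmemR : bb ∈ htRU cH wH := by
        refine List.mem_filter.2 ⟨huniv, ?_⟩
        simp only [Bool.and_eq_true, Bool.not_eq_true', decide_eq_true_eq]
        exact ⟨by simpa using hin, hlo⟩
      exact ⟨List.mem_toFinset.2 hmemR, six_le_norm_of_lo U hboxH ξ hξH (hROK' bb hmemR)⟩
  -- the slope bound at the reference over B (second-order centred chunk with L := htBU hull at the CELL box)
  have hf₀ := refForce_chunkA2_le (htBU_nodup cH wH) hNai U hU hboxC (by simpa [hξ₀def] using hn₀) ξ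
  rw [← hBdef] at hf₀
  -- the chain
  set m : ℕ := ch.length with hmdef
  have hm : 0 < m := hlen
  simp only [extCurvAll, List.all_eq_true, List.mem_range] at hcurvs
  simp only [extFloorAll, List.all_eq_true, List.mem_range] at hfloors
  simp only [extGeomOK, List.all_eq_true, List.mem_range, Bool.and_eq_true, decide_eq_true_eq] at hgeom
  obtain ⟨⟨⟨hsameK, hC0⟩, hSlast⟩, hnestK⟩ := hgeom
  have hLB : ∀ k, k < m → ((htBU cH wH).filter (fun b => ljLabelOK (chC ch k) (chW ch k) b) ++
      (htBU cH wH).filter (fun b => !ljLabelOK (chC ch k) (chW ch k) b)).toFinset = B :=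
    fun k _ => by rw [hBdef]; exact toFinset_filter_append _ _
  have hnd : ∀ k, k < m → ((htBU cH wH).filter (fun b => ljLabelOK (chC ch k) (chW ch k) b) ++
      (htBU cH wH).filter (fun b => !ljLabelOK (chC ch k) (chW ch k) b)).Nodup :=
    fun k _ => nodup_filter_append (htBU_nodup cH wH) _
  have hchk : ∀ k, k < m → curvCheckLJM (chC ch k) (chW ch k) ((htBU cH wH).filter fun b => ljLabelOK (chC ch k) (chW ch k) b)
      ((htBU cH wH).filter fun b => !ljLabelOK (chC ch k) (chW ch k) b) (chD ch k) (chL ch k) = true :=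
    fun k hk => hcurvs k hk
  have hUbox : ∀ k, k < m → ∀ ab : Fin 3 × Fin 3,
      |(U (EuclideanSpace.single ab.2 (1 : ℝ))) ab.1 - (chC ch k (Sum.inl ab) : ℝ) / SC| ≤ (chW ch k (Sum.inl ab) : ℝ) / SC :=
    fun k hk => hbox_of_sameU (hsameK k hk) hbox
  have hnest : ∀ k, k + 1 < m → ∀ j : Fin 3, chC ch (k + 1) (Sum.inr j) - chW ch (k + 1) (Sum.inr j) ≤ chC ch k (Sum.inr j) - chW ch k (Sum.inr j) ∧
      chC ch k (Sum.inr j) + chW ch k (Sum.inr j) ≤ chC ch (k + 1) (Sum.inr j) + chW ch (k + 1) (Sum.inr j) := by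
    intro k hk j
    have h' := hnestK k (by omega) hk
    simp only [xiSub, decide_eq_true_eq] at h'
    exact h' j
  have h0 := hxi_of_xiSub hC0 hξ₀C
  have h1 := hxi_of_xiSub hSlast hξ
  -- the gap: hΔ and the domination
  have hΔ : U (ξ - ξ₀) ≠ 0 := U_sub_ne_zero_of_gap (c₀ := cC) (w₀ := jwBox J wC) hU i hg hξ hξ₀J hgap
  have hℓ : ∀ k, k < m → ((lmin : ℝ) / SC) * ‖U (ξ - ξ₀)‖ ^ 2 ≤
      (chL ch k : ℝ) / SC * ‖U (ξ - ξ₀)‖ ^ 2 + ∑ i : Fin 3, ∑ j : Fin 3, (chD ch k i j : ℝ) / SC * ((U (ξ - ξ₀)) i * (U (ξ - ξ₀)) j) :=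
    fun k hk => floorOK_sound (hfloors k hk) _
  -- the domination inequality from the integers
  have hRcard : (R.card : ℝ) ≤ ((htRU cH wH).length : ℝ) := by
    rw [hRdef]; exact_mod_cast List.toFinset_card_le _
  have hS7 : (6000 / 343 * (7 : ℝ)⁻¹ ^ 4 + 2880 / 49 * (7 : ℝ)⁻¹ ^ 5 + 10 / 7 * (7 : ℝ)⁻¹ ^ 6 + 2 * (7 : ℝ)⁻¹ ^ 7) = 8892 / 823543 := by norm_num
  have h67 : ((6 : ℝ)⁻¹ ^ 7) = 1 / 279936 := by norm_num
  have hZ : (4 * (SC : ℝ) ^ 2 * 8892 * 279936 + 4 * (SC : ℝ) * (htGsA2 cC wC J (htBU cH wH) : ℝ) * 230539333248 +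
      4 * (SC : ℝ) ^ 2 * ((htRU cH wH).length : ℝ) * 823543) < 3 * (lmin : ℝ) * (g : ℝ) * 230539333248 := by exact_mod_cast hdomZ
  have hlmin0 : (0 : ℝ) ≤ (lmin : ℝ) / SC := div_nonneg (by exact_mod_cast hlmin) hS.le
  have hK : (6000 / 343 * (7 : ℝ)⁻¹ ^ 4 + 2880 / 49 * (7 : ℝ)⁻¹ ^ 5 + 10 / 7 * (7 : ℝ)⁻¹ ^ 6 + 2 * (7 : ℝ)⁻¹ ^ 7) +
      (htGsA2 cC wC J (htBU cH wH) : ℝ) / SC + R.card * (6 : ℝ)⁻¹ ^ 7 < (lmin : ℝ) / SC * (3 / 4 * ((g : ℝ) / SC)) := by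
    rw [hS7, h67]
    have hSC : (SC : ℝ) = 281474976710656 := by norm_num [SC]
    rw [hSC] at hZ ⊢
    have hR67 : (R.card : ℝ) * (1 / 279936) ≤ ((htRU cH wH).length : ℝ) * (1 / 279936) := mul_le_mul_of_nonneg_right hRcard (by norm_num)
    nlinarith [hZ, hR67]
  have hdom := dom_of_gap (c₀ := cC) (w₀ := jwBox J wC) hU i hξ hξ₀J hgap hlmin0 hK
  -- assemble
  exact hver_exterior_of_curvChecks_uniformFloor (μ := μ) hU hn₀ hn B R hB hBin hR hf₀ m hm (chC ch) (chW ch)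
    (fun k => (htBU cH wH).filter fun b => ljLabelOK (chC ch k) (chW ch k) b) (fun k => (htBU cH wH).filter fun b => !ljLabelOK (chC ch k) (chW ch k) b)
    (chD ch) (chL ch) hLB hnd hchk hUbox hnest h0 h1 hΔ hℓ hdom

end Summit.AtomisticToContinuum.Crystallization.Theorems.FrustratedLawDichotomyStrainedPatchHomExteriorRay

end
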